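import Mathlib.GroupTheory.SpecificGroups.Cyclic
import Mathlib.SetTheory.Cardinal.Finite
import Literature.Topology.FourManifolds.HomotopySpheresBP
import Literature.Topology.FourManifolds.HCobordism
import Literature.Topology.FourManifolds.SmoothOrientationSphereProofs
import Literature.Topology.FourManifolds.ClosedBallParallelizable
import HarnessLib

/-!
# The order of `bP₈` and `|Θ₇| = 28`

Trunk T-4MAN (`FourManifolds`). Second layer under the named fact
`Literature.SPC4.natCard_homotopySphereClass_seven : Nat.card (HomotopySphereClass 7) = 28`
(`HCobordism.lean`; Kervaire–Milnor, *Groups of homotopy spheres I*, Ann. of Math. 77 (1963),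
table p. 504). Kervaire–Milnor compute `Θ₇` in two steps,

1. `Θ₇ = bP₈` (§4: `Θₙ / bPₙ₊₁ ↪ Πₙ / p(Sⁿ) = coker Jₙ`, Thm. 4.1 with Lemmas 4.2–4.5, and
   `Π₇ / p(S⁷) = 0`, table p. 512) — the named fact `Literature.Topology.FourManifolds.HomotopySphere.boundsParallelizable_seven`
   of `HomotopySpheresBP.lean`;
2. `bP₈` is cyclic of order `28` (§7: Thm. 7.5, Cor. 7.6 and the "Discussion and computations",
   pp. 530–531: `bP₄ₘ` is cyclic of order `σₘ/8`, the proof being deferred to the never-published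
   Part II; complete printed proof: Kosinski, *Differential Manifolds* (1993), Ch. X, Prop. 6.2(a)
   p. 216 and p. 217, "since `t₂/8 = 28`, it follows that `bP⁸ = ℤ₂₈`, generated by `∂M(8)`") —
   vendored here as the named fact `Literature.Topology.FourManifolds.HomotopySphereClass.natCard_bP_seven`,

and this file proves the assembly `Literature.Topology.FourManifolds.natCard_homotopySphereClass_seven_of_bP`: facts 1 and 2
imply `|Θ₇| = 28` (indeed, granted fact 1, fact 2 is *equivalent* to it,
`HomotopySphereClass.natCard_bP_seven_iff`). It also records the printed form "`Θ₇ ≅ ℤ₂₈`"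
(`SPC4.nonempty_mulEquiv_zmod_twentyEight_of`, from `|Θ₇| = 28` and the cyclicity fact
`Literature.Topology.FourManifolds.exists_commGroup_homotopySphereClass_isCyclic_seven`), and closes the gap "`𝔻ⁿ⁺¹` is
parallelizable, so `[𝕊ⁿ] ∈ bPₙ₊₁`" left open in `HomotopySpheresBP.lean` (module docstring, last
design note), using `Literature.Topology.FourManifolds.IsParallelizable.closedBall` (`ClosedBallParallelizable.lean`):
`boundsParallelizable_sphere`, `HomotopySphereClass.mk_sphere_mem_bP`,
`HomotopySphereClass.bP_nonempty`, `HomotopySphereClass.one_mem_bP` (Kervaire–Milnor 1963, §4,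
proof of Lemma 4.2: `Sⁿ = bDⁿ⁺¹`; Kosinski 1993, Ch. X §6, p. 216: the unit of `Pᵐ` is the framed
disc `Dᵐ`).

## Main statements

* `Literature.Topology.FourManifolds.boundsParallelizable_sphere` (proved): `𝕊ⁿ` bounds a parallelizable manifold, namely
  `𝔻ⁿ⁺¹`; hence `[𝕊ⁿ] ∈ bPₙ₊₁` for every orientation (`HomotopySphereClass.mk_sphere_mem_bP`),
  `bPₙ₊₁ ≠ ∅` (`HomotopySphereClass.bP_nonempty`), and `1 ∈ bPₙ₊₁` for every group structure on
  `Θₙ` in which the class of `𝕊ⁿ`, with every orientation, is the unit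
  (`HomotopySphereClass.one_mem_bP`; this is the unit clause of
  `Literature.Topology.FourManifolds.exists_commGroup_homotopySphereClass`).
* `Literature.Topology.FourManifolds.HomotopySphereClass.natCard_bP_seven` (named fact): `Nat.card (bP 7) = 28`.
* `Literature.Topology.FourManifolds.natCard_homotopySphereClass_seven_of_bP` (proved): facts 1 and 2 give
  `Literature.Topology.FourManifolds.natCard_homotopySphereClass_seven`; `HomotopySphereClass.natCard_bP_seven_iff`
  (proved): under fact 1 the two cardinality statements are equivalent.
* `Literature.Topology.FourManifolds.nonempty_mulEquiv_zmod_twentyEight_of` (proved): a cyclic group structure on `Θ₇`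
  with `|Θ₇| = 28` is isomorphic to `ℤ/28`; `Literature.Topology.FourManifolds.exists_commGroup_mulEquiv_zmod_of` assembles
  "`Θ₇ ≅ ℤ₂₈` as groups under connected sum" from the two `HCobordism.lean` facts.

## The printed proof of fact 2 (plan of the deeper layers; not formalised)

Kosinski 1993, Ch. X §6, proof of Prop. 6.2(a), pp. 216–217, for `m = 4n - 1 = 7`: let `P⁸` be the
group (under boundary connected sum, up to framed cobordism) of framed compact `8`-manifolds
bounded by homotopy spheres and `P₀⁸ ⊆ P⁸` those with boundary diffeomorphic to `S⁷`; the
sequence `0 → P₀⁸ → P⁸ → θ⁷` ((6.1), boundary map, exact by VIII.4.5 = h-cobordism theorem) has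
image `bP⁸`. The signature `σ : P⁸ → ℤ` is an injective homomorphism (X.3.2–3.4: a parallelizable
`W⁸` with homotopy-sphere boundary and `σ(W) = 0` can be surgered to a contractible manifold;
Kervaire–Milnor Lemma 7.3) with image `8ℤ` (the intersection form is even and unimodular, so
`8 ∣ σ`; Milnor's `E₈`-plumbing `M(8)` of VI.12 has `σ = 8`, IX.7.5), and `σ(P₀⁸) = t₂ ℤ` with
`t₂ = 2⁵ (2³ - 1) · B₂ · j₂ · a₂ / 8 = 224` the minimal positive signature of an
almost-parallelizable closed `8`-manifold (IX.8.5, IX.8.7: Hirzebruch's signature theorem, Bott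
periodicity and `j₂ = |im J₇| = 240`; Milnor–Kervaire 1958, cited as [18, p. 457] by
Kervaire–Milnor p. 530). Hence
`bP⁸ ≅ P⁸/P₀⁸ ≅ 8ℤ/224ℤ ≅ ℤ/28`. Kervaire–Milnor's own route (Thm. 7.5: `Σ₁` h-cobordant to `Σ₂`
iff `σ(M₁) ≡ σ(M₂) mod σₘ`; Cor. 7.6: `bP₄ₘ ↪ ℤ/σₘ`) is the same argument phrased on `Θ₄ₘ₋₁`.
Formalising any of these layers needs the signature of a compact oriented `4m`-manifold with
boundary; the tree's route is the closed-space intersection form `Literature.AlgebraicTopology.SingularHomology.intersectionForm`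
(`Literature/AlgebraicTopology/SingularHomology/IntersectionForm.lean`) of the capped-off manifold
`W/∂W = W ∪ cone(∂W)` (Kervaire–Milnor, proof of Lemma 7.3, pp. 528–529), provided as
`Literature.Topology.FourManifolds.NullCobordism.signature` in `NullCobordismSignature.lean`; surgery, plumbing and the
signature theorem are absent from Mathlib and from the tree.

## Design choices

* Nothing is fixed about the group structure of `Θ₇`: as in `HomotopySpheresBP.lean`, statements
  involving the group law quantify over all `CommGroup` structures whose multiplication is the
  relational connected sum `HomotopySphereClass.IsMul` (they exist and are unique by the named
  facts `Literature.Topology.FourManifolds.exists_commGroup_homotopySphereClass`, `HomotopySphereClass.isMul_exists`).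
* Fact 2 is stated as a bare cardinality, `Nat.card (bP 7) = 28`, on the tree's `bP 7 : Set (Θ₇)`;
  cyclicity of `bP₄ₘ` is the separate fact `HomotopySphereClass.isCyclic_bP_four_mul` of
  `HomotopySpheresBP.lean` (Kervaire–Milnor Cor. 7.6), so that the two together say "`bP₈` is cyclic
  of order `28`" (Kosinski X.6.2(a)). `Θ₇ = HomotopySphereClass 7` is the oriented-diffeomorphism
  quotient, which for `n = 7 ≥ 5` is Kervaire–Milnor's and Kosinski's h-cobordism group (Smale;
  `HomotopySphere.isHCobordant_iff_nonempty_diffeomorph_of_five_le`; Kosinski VIII, Cor. 5.6), so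
  the count `28` is the printed one (the unoriented count would be `15`).

## References

* M. Kervaire, J. Milnor, *Groups of homotopy spheres I*, Ann. of Math. 77 (1963), 504–537: table
  p. 504; §4 (bPₙ₊₁, Lemma 4.2, Thm. 4.1, table p. 512); §7 (Lemma 7.3, Thm. 7.5, Cor. 7.6,
  Discussion pp. 530–531, formula (2)). [KervaireMilnorAnnals1963]
* A. Kosinski, *Differential Manifolds*, Academic Press (1993), Ch. X §6: (6.1), Prop. 6.2(a)
  p. 216, p. 217 (`bP⁸ = ℤ₂₈`), (6.6) and pp. 218–219 (`θ⁷ = ℤ₂₈`). [Kosinski1993]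
* J. Milnor, *Lectures on the h-cobordism theorem* (1965), Thm. 9.1. [MilnorHCobordism1965]
-/

open scoped Manifold ContDiff Topology
open Set Function

noncomputable section

namespace Literature.Topology.FourManifolds

universe u

/-- Local notation: `𝔼 n` is the model Euclidean space `EuclideanSpace ℝ (Fin n)`. -/
local notation "𝔼 " n:arg => EuclideanSpace ℝ (Fin n)

/-- Local notation: `𝕊 n` is the unit sphere in `EuclideanSpace ℝ (Fin (n + 1))`. -/
local notation "𝕊 " n:arg => (Metric.sphere (0 : EuclideanSpace ℝ (Fin (n + 1))) 1)

/-- Local notation: `𝔻 n` is the closed unit ball in `EuclideanSpace ℝ (Fin n)` (a compact smooth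
manifold with boundary, `Literature.Topology.FourManifolds.instChartedSpaceClosedBall`, `ClosedBall.lean`). -/
local notation "𝔻 " n:arg => (Metric.closedBall (0 : EuclideanSpace ℝ (Fin n)) 1)

/-! ### `[𝕊ⁿ] ∈ bPₙ₊₁`: the standard sphere bounds the parallelizable disc -/

/-- **`𝕊ⁿ` bounds a parallelizable manifold**, namely the disc: `𝕊ⁿ = ∂𝔻ⁿ⁺¹`
(`NullCobordism.closedBall`) and `𝔻ⁿ⁺¹` is parallelizable (`IsParallelizable.closedBall`, the
pull-back of the constant frame of `ℝⁿ⁺¹`). Kervaire–Milnor, *Groups of homotopy spheres I* (1963),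
§4, proof of Lemma 4.2 ("`Sⁿ = bDⁿ⁺¹`", so `Sⁿ` represents the neutral element of `bPₙ₊₁`);
Kosinski, *Differential Manifolds* (1993), Ch. X §6, p. 216 (the unit of `Pᵐ` is the framed disc
`Dᵐ`). [cite: KervaireMilnorAnnals1963, §4, Lemma 4.2 (Sⁿ = bDⁿ⁺¹)] -/
theorem boundsParallelizable_sphere (n : ℕ) : BoundsParallelizable n (𝕊 n) :=
  ⟨NullCobordism.closedBall n, IsParallelizable.closedBall n⟩

/-- A closed smooth `n`-manifold diffeomorphic to the standard sphere bounds a parallelizable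
manifold (transport of `boundsParallelizable_sphere` along the diffeomorphism;
Kervaire–Milnor 1963, §4, Lemma 4.2). [cite: KervaireMilnorAnnals1963, §4, Lemma 4.2] -/
theorem boundsParallelizable_of_nonempty_diffeomorph_sphere {n : ℕ} {M : Type}
    [TopologicalSpace M] [ChartedSpace (𝔼 n) M] [IsManifold (𝓡 n) ∞ M]
    (h : Nonempty (M ≃ₘ⟮𝓡 n, 𝓡 n⟯ (𝕊 n))) : BoundsParallelizable n M := by
  obtain ⟨φ⟩ := h
  exact (boundsParallelizable_sphere n).of_diffeomorph φ.symm

namespace HomotopySphere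

variable {n : ℕ}

/-- The standard sphere, with any orientation, bounds a parallelizable manifold as a homotopy
sphere (Kervaire–Milnor 1963, §4, Lemma 4.2: `Sⁿ = bDⁿ⁺¹`). [cite: KervaireMilnorAnnals1963, §4, Lemma 4.2] -/
theorem boundsParallelizable_sphere (o : SmoothOrientation (𝓡 n) (𝕊 n)) :
    (⟨𝕊 n, o, ⟨.refl _⟩⟩ : HomotopySphere n).BoundsParallelizable :=
  Literature.Topology.FourManifolds.boundsParallelizable_sphere n

/-- A homotopy sphere whose carrier is diffeomorphic to `𝕊ⁿ` (with either orientation) bounds a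
parallelizable manifold (Kervaire–Milnor 1963, §4, Lemma 4.2 with §1). [cite: KervaireMilnorAnnals1963, §4, Lemma 4.2] -/
theorem boundsParallelizable_of_nonempty_diffeomorph_sphere (S : HomotopySphere n)
    (h : Nonempty (S.carrier ≃ₘ⟮𝓡 n, 𝓡 n⟯ (𝕊 n))) : S.BoundsParallelizable :=
  Literature.Topology.FourManifolds.boundsParallelizable_of_nonempty_diffeomorph_sphere h

end HomotopySphere

namespace HomotopySphereClass

variable {n : ℕ}

/-- **`[𝕊ⁿ] ∈ bPₙ₊₁`** for every orientation of `𝕊ⁿ`: the class of the standard sphere lies in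
Kervaire–Milnor's `bPₙ₊₁` (*Groups of homotopy spheres I* (1963), §4, Lemma 4.2: `Sⁿ = bDⁿ⁺¹`
bounds the parallelizable disc, and represents the neutral element). [cite: KervaireMilnorAnnals1963, §4, Lemma 4.2] -/
theorem mk_sphere_mem_bP (o : SmoothOrientation (𝓡 n) (𝕊 n)) :
    mk ⟨𝕊 n, o, ⟨.refl _⟩⟩ ∈ bP n :=
  mk_mem_bP (HomotopySphere.boundsParallelizable_sphere o)

variable (n) in
/-- `bPₙ₊₁` is nonempty: it contains the class of the standard sphere, which is orientable
(`isOrientable_sphere_holds`) and bounds the parallelizable disc (Kervaire–Milnor 1963, §4).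
Non-vacuity witness for `HomotopySphereClass.bP`. [cite: KervaireMilnorAnnals1963, §4, Lemma 4.2] -/
theorem bP_nonempty : (bP n).Nonempty := by
  obtain ⟨o⟩ := isOrientable_sphere_holds n
  exact ⟨_, mk_sphere_mem_bP o⟩

/-- **`bPₙ₊₁` contains the unit of `Θₙ`**: for any group structure on `Θₙ` in which the class of
the standard sphere (with every orientation) is the unit — as provided by the named fact
`Literature.Topology.FourManifolds.exists_commGroup_homotopySphereClass` (Kervaire–Milnor 1963, Thm. 1.1, Lemma 2.2: `Sⁿ` is
the identity for `#`) — the unit lies in `bPₙ₊₁` (§4: `bPₙ₊₁` is a subgroup). [cite: KervaireMilnorAnnals1963, §4 and Thm. 1.1] -/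
theorem one_mem_bP [CommGroup (HomotopySphereClass n)]
    (h1 : ∀ o : SmoothOrientation (𝓡 n) (𝕊 n),
      (mk ⟨𝕊 n, o, ⟨.refl _⟩⟩ : HomotopySphereClass n) = 1) :
    (1 : HomotopySphereClass n) ∈ bP n := by
  obtain ⟨o⟩ := isOrientable_sphere_holds n
  exact h1 o ▸ mk_sphere_mem_bP o

/-! ### Named fact: `|bP₈| = 28` -/

/-- **`bP₈` has order `28`** (named fact). The subset `bP₈ ⊆ Θ₇` (`HomotopySphereClass.bP 7`) of
classes of homotopy `7`-spheres bounding parallelizable manifolds has exactly `28` elements.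
Kervaire–Milnor, *Groups of homotopy spheres I*, Ann. of Math. 77 (1963), §7: by Thm. 7.5 (homotopy
`(4m-1)`-spheres `Σ₁ = bM₁`, `Σ₂ = bM₂` bounding s-parallelizable manifolds, `m > 1`, are
h-cobordant iff `σ(M₁) ≡ σ(M₂) mod σₘ`) and Cor. 7.6, `bP₄ₘ` embeds in the cyclic group of order
`σₘ`, and (Discussion and computations, p. 530) "In Part II we will see that `bP₄ₘ` is cyclic of
order precisely `σₘ/8`. In fact a given integer `σ` occurs as `σ(M)` for some s-parallelizable `M`
bounded by a homotopy sphere if and only if `σ ≡ 0 (modulo 8)`", with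
`σₘ = 2^(2m-1) (2^(2m-1) - 1) Bₘ jₘ aₘ / m` (Milnor–Kervaire 1958), i.e. for `m = 2`
(`B₂ = 1/30`, `j₂ = 240`, `a₂ = 1`): `σ₂ = 224` and `|bP₈| = 28`, the entry `Θ₇ : 28` of the table
p. 504 (Part II never appeared). Complete printed proof: Kosinski, *Differential Manifolds* (1993),
Ch. X, Prop. 6.2(a), p. 216 (`bP⁴ⁿ` is finite cyclic of order `tₙ/8`, `n > 1`: the signature is
an injective homomorphism on the group `P⁴ⁿ` of framed manifolds bounded by homotopy spheres,
X.3.4, with image `8ℤ` — even unimodular forms and the `E₈`-plumbing `M(4n)`, VI.12, IX.7.5 — and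
image `tₙ ℤ` on those bounded by the standard sphere, IX.8.5, IX.8.7) and p. 217: "Since
`t₂/8 = 28`, it follows that `bP⁸ = ℤ₂₈`, generated by `∂M(8)`." For `n = 7 ≥ 5` the h-cobordism
classes of both sources are the oriented diffeomorphism classes of `HomotopySphereClass 7`
(Smale; Kosinski VIII, Cor. 5.6). Not proved here: signatures of manifolds with boundary, surgery,
plumbing and `t₂ = 224` are absent from Mathlib and from the tree (see the module docstring for
the layer plan). [cite: KervaireMilnorAnnals1963, §7: Thm. 7.5, Cor. 7.6 and Discussion pp. 530–531 (bP₄ₘ cyclic of order σₘ/8); table p. 504 (Θ₇: 28)] [cite: Kosinski1993, Ch. X §6, Prop. 6.2(a) p. 216 and p. 217 (t₂/8 = 28, bP⁸ = ℤ₂₈)] -/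
def natCard_bP_seven : Prop :=
  Nat.card (bP 7) = 28

end HomotopySphereClass

/-! ### Assembly: `|Θ₇| = 28` from `Θ₇ = bP₈` and `|bP₈| = 28` -/

/-- **Assembly of `|Θ₇| = 28`.** If every homotopy `7`-sphere bounds a parallelizable manifold
(`Θ₇ = bP₈`, the named fact `HomotopySphere.boundsParallelizable_seven`; Kervaire–Milnor 1963, §4,
table p. 512) and `|bP₈| = 28` (the named fact `HomotopySphereClass.natCard_bP_seven`; §7,
pp. 530–531), then `Θ₇ = HomotopySphereClass 7` has exactly `28` elements, i.e. the named fact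
`Literature.Topology.FourManifolds.natCard_homotopySphereClass_seven` of `HCobordism.lean` holds (Kervaire–Milnor 1963,
table p. 504; Kosinski 1993, Ch. X §6, pp. 218–219: "since `Coker J₇ = 0`, `θ⁷ = ℤ₂₈`"). [cite: KervaireMilnorAnnals1963, table p. 504, with §4 table p. 512 and §7 pp. 530–531] [cite: Kosinski1993, Ch. X §6, (6.6) and pp. 218–219 (θ⁷ = ℤ₂₈)] -/
theorem natCard_homotopySphereClass_seven_of_bP
    (h₁ : HomotopySphere.boundsParallelizable_seven)
    (h₂ : HomotopySphereClass.natCard_bP_seven) :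
    FourManifolds.natCard_homotopySphereClass_seven := by
  unfold FourManifolds.natCard_homotopySphereClass_seven
  unfold HomotopySphereClass.natCard_bP_seven at h₂
  rwa [HomotopySphereClass.bP_seven_eq_univ h₁, Nat.card_univ] at h₂

/-- Granted `Θ₇ = bP₈` (`HomotopySphere.boundsParallelizable_seven`), `|bP₈| = 28` is *equivalent*
to `|Θ₇| = 28`: the decomposition loses nothing (Kervaire–Milnor 1963, §4 table p. 512 and table
p. 504). [cite: KervaireMilnorAnnals1963, §4 table p. 512 and table p. 504] -/
theorem HomotopySphereClass.natCard_bP_seven_iff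
    (h₁ : HomotopySphere.boundsParallelizable_seven) :
    HomotopySphereClass.natCard_bP_seven ↔ FourManifolds.natCard_homotopySphereClass_seven := by
  unfold FourManifolds.natCard_homotopySphereClass_seven HomotopySphereClass.natCard_bP_seven
  rw [HomotopySphereClass.bP_seven_eq_univ h₁, Nat.card_univ]

/-! ### Corollaries of `|Θ₇| = 28` -/

/-- `|Θ₇| = 28` implies that `Θ₇` is finite (Kervaire–Milnor 1963, Thm. 1.2 for `n = 7`; the
general finiteness is the separate fact `Literature.Topology.FourManifolds.finite_homotopySphereClass`). [cite: KervaireMilnorAnnals1963, Thm. 1.2 and table p. 504] -/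
theorem finite_homotopySphereClass_seven_of (h : FourManifolds.natCard_homotopySphereClass_seven) :
    Finite (HomotopySphereClass 7) :=
  Nat.finite_of_card_ne_zero (by rw [h]; decide)

/-- `|Θ₇| = 28` implies that there are at least two oriented diffeomorphism classes of homotopy
`7`-spheres, i.e. `Θ₇` is nontrivial: exotic `7`-spheres exist (Milnor 1956; Kervaire–Milnor
1963, table p. 504). [cite: KervaireMilnorAnnals1963, table p. 504] -/
theorem nontrivial_homotopySphereClass_seven_of
    (h : FourManifolds.natCard_homotopySphereClass_seven) : Nontrivial (HomotopySphereClass 7) := by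
  have : Finite (HomotopySphereClass 7) := FourManifolds.finite_homotopySphereClass_seven_of h
  rw [← Finite.one_lt_card_iff_nontrivial, h]
  decide

/-- **`Θ₇ ≅ ℤ/28` from cyclicity and the order.** Any group structure on `Θ₇` which is cyclic and
has `28` elements is isomorphic to (the multiplicative form of) `ℤ/28` (Mathlib's
`zmodCyclicMulEquiv`). With the named facts
`Literature.Topology.FourManifolds.exists_commGroup_homotopySphereClass_isCyclic_seven` and
`Literature.Topology.FourManifolds.natCard_homotopySphereClass_seven` this is Kervaire–Milnor's "`Θ₇ ≅ ℤ₂₈`"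
(*Groups of homotopy spheres I* (1963), table p. 504 with Thm. 1.1; Kosinski 1993, Ch. X §6,
pp. 218–219). [cite: KervaireMilnorAnnals1963, Thm. 1.1 and table p. 504] -/
theorem nonempty_mulEquiv_zmod_twentyEight_of [Group (HomotopySphereClass 7)]
    (hc : IsCyclic (HomotopySphereClass 7)) (h : FourManifolds.natCard_homotopySphereClass_seven) :
    Nonempty (HomotopySphereClass 7 ≃* Multiplicative (ZMod 28)) := by
  unfold FourManifolds.natCard_homotopySphereClass_seven at h
  exact ⟨(h ▸ zmodCyclicMulEquiv hc).symm⟩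

/-- **`Θ₇ ≅ ℤ₂₈` as groups under connected sum** (assembly from the two `HCobordism.lean` facts):
if `Θ₇` carries a cyclic commutative group structure whose multiplication is the connected sum
(`Literature.Topology.FourManifolds.exists_commGroup_homotopySphereClass_isCyclic_seven`) and `|Θ₇| = 28`
(`Literature.Topology.FourManifolds.natCard_homotopySphereClass_seven`), then there is a commutative group structure on
`Θ₇` with multiplication the connected sum and a group isomorphism `Θ₇ ≃* ℤ/28`
(Kervaire–Milnor 1963, Thm. 1.1 and table p. 504; Kosinski 1993, Ch. X §6, pp. 218–219,
"`θ⁷ = ℤ₂₈`"). [cite: KervaireMilnorAnnals1963, Thm. 1.1 and table p. 504] [cite: Kosinski1993, Ch. X §6, pp. 218–219 (θ⁷ = ℤ₂₈)] -/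
theorem exists_commGroup_mulEquiv_zmod_of
    (h₁ : FourManifolds.exists_commGroup_homotopySphereClass_isCyclic_seven)
    (h₂ : FourManifolds.natCard_homotopySphereClass_seven) :
    ∃ _ : CommGroup (HomotopySphereClass 7),
      (∀ a b c : HomotopySphereClass 7, HomotopySphereClass.IsMul a b c → a * b = c) ∧
        Nonempty (HomotopySphereClass 7 ≃* Multiplicative (ZMod 28)) := by
  obtain ⟨inst, hmul, hcyc⟩ := h₁
  exact ⟨inst, hmul, FourManifolds.nonempty_mulEquiv_zmod_twentyEight_of hcyc h₂⟩

/-- Under `Θ₇ = bP₈` and `|bP₈| = 28`, together with the cyclicity fact, `Θ₇ ≅ ℤ₂₈` as groups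
under connected sum: the full assembly of Kervaire–Milnor's computation of `Θ₇` from the three
second-layer facts of `HomotopySpheresBP.lean` / this file and the cyclicity fact of
`HCobordism.lean` (Kervaire–Milnor 1963, §§4, 7 and table p. 504). [cite: KervaireMilnorAnnals1963, §4 table p. 512, §7 pp. 530–531 and table p. 504] -/
theorem exists_commGroup_mulEquiv_zmod_of_bP
    (h₀ : FourManifolds.exists_commGroup_homotopySphereClass_isCyclic_seven)
    (h₁ : HomotopySphere.boundsParallelizable_seven)
    (h₂ : HomotopySphereClass.natCard_bP_seven) :
    ∃ _ : CommGroup (HomotopySphereClass 7),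
      (∀ a b c : HomotopySphereClass 7, HomotopySphereClass.IsMul a b c → a * b = c) ∧
        Nonempty (HomotopySphereClass 7 ≃* Multiplicative (ZMod 28)) :=
  FourManifolds.exists_commGroup_mulEquiv_zmod_of h₀ (FourManifolds.natCard_homotopySphereClass_seven_of_bP h₁ h₂)

end Literature.Topology.FourManifolds
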